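import Mathlib
import HarnessLib
import Literature.MathematicalPhysics.StatisticalMechanics.RenormalisationMapLipschitzSubABKM
import Literature.MathematicalPhysics.StatisticalMechanics.RenormalisationMapSmallnessTerms
import Literature.MathematicalPhysics.StatisticalMechanics.RenormalisationMapSplit
import Literature.MathematicalPhysics.StatisticalMechanics.RenormalisationMapZero

/-!
# The third remainder sum (disconnected preimages) of the renormalisation map is Lipschitz-small
# ([ABKM19] Lemma 9.6 / Thm 6.8)

CH12-PLAN §5 (e2), second assembled piece (companion of RenormalisationMapRemainderFour).  In the decomposition
`S(H,K)(U) − C_kK(U) = Σ_{blocks} + Σ_{large connected} + Σ_{disconnected} + Σ_{∅≠X₁⊊X}`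
(`GradientRG.nextKStep_sub_opC_eq`, RenormalisationMapRemainder) the third sum
`Σ₃(H̃,H,K)(U,φ) = Σ_{π(X)=U, X disconnected} (e^{−H̃})^{U∖X}(e^{H̃})^{X∖U}·(R_{k+1}[P₂(e^{−H},K)(X)](φ) + (1−e^{−H̃})^X(φ))`
(the two reblocked terms `X₁ = ∅` and `X₁ = X` of a disconnected preimage, `R P₂(∅) = 1`) is Lipschitz in `(H̃,H,K)` in `|·|_{T_{k+1}^{U*}, w_{k+1}^U}` with a constant of the form
`(3Δ + Δ_H + C_Δ) · ω A⁴ · κ^{|U|_k} · c(d,L,κ,A_𝒫)^{|U|_{k+1}} · A^{−η(d)|U|_{k+1}}`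
(`Δ = 16e^{3/8}‖H̃−H̃'‖_{k,0}`, `Δ_H = 16e^{3/8}‖H−H'‖_{k,0}`, `C_Δ = ‖K−K'‖_k`), whenever all the
smallness carriers `8e^{1/4}τ + Δ`, `8e^{1/4}‖H‖`, `8e^{1/4}‖H'‖ + Δ_H`, `‖K‖ + ‖K−K'‖` are `≤ ω` with
`ω A² ≤ 1`: the explicit per-term Lipschitz bound (`tayNormLE_subsum_reblockTerm_sub_abkm`), the
smallness adapter (`TorusPolymer.reblockTerm_lipschitzConsts_le`, degree `≥ 2` by
`TorusPolymer.two_le_degree_of_ne_self` / `two_le_degree_self_of_not_isConn`: a disconnected preimage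
has `≥ 2` components, hence `≥ 2` blocks) and the master animal bound with Brydges' gain
(`TorusPolymer.sum_reblock_triples_le_pow`).  Since `η(d) > 1`, the factor
`c^{|U|_{k+1}} A^{−η(d)|U|_{k+1}} ≤ A^{−|U|_{k+1}}` once `A^{η(d)−1} ≥ c` — the contraction bookkeeping of
step (e3).

* **`tayNormLE_remainderThree_sub_abkm`** — the displayed bound (`U ≠ ∅`).

Everything is proved; no named fact.

## References
* S. Adams, S. Buchholz, R. Kotecký, S. Müller, arXiv:1910.13564, Theorem 6.8, Lemma 9.6 (proof,
  (9.36)–(9.39)) [AdamsBuchholzKoteckyMuller2019].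
* D. C. Brydges, IAS/Park City Math. Ser. 16 (2009), Lemma 6.15 [Brydges2009].
-/

noncomputable section

namespace Literature.MathematicalPhysics.StatisticalMechanics.GradientRG

open scoped BigOperators Classical
open Finset Matrix
open Literature.MathematicalPhysics.StatisticalMechanics.TorusPolymer
  (IsPolymer blocks polys bprod blockOf reblock mem_polys mem_blocks numBlocks
    card_blocks_eq_numBlocks reblockTerm_lipschitzConsts_le two_le_degree_of_ne_self
    two_le_degree_self_of_not_isConn two_le_card_blocks_of_not_isConn sum_reblock_triples_le_pow
    empty_mem_polys self_mem_polys bprod_empty reblock_empty)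
open Literature.Barriers.CriticalPhenomena.LongRangePhi4.Polymer (IsConn components)
open Literature.MathematicalPhysics.QuantumFieldTheory

variable {d M : ℕ} [NeZero M]

/-- **The third remainder sum is Lipschitz-small** (see the module docstring): torus data as in
`tayNormLE_subsum_reblockTerm_sub_abkm`, `U ≠ ∅`; smallness carriers `≤ ω`, `ω A² ≤ 1`, `A ≥ 1`,
`κ ≥ 1 + e^{1/4} + 16e^{3/8}‖H̃−H̃'‖_{k,0}`.  The constant is
`κ^{|U|_k}(3Δ+Δ_H+C_Δ)ωA⁴ · ((2(2κ max(1,A_𝒫)))^{c(d)L^d} 4^{c(d)L^d})^{|U|_{k+1}} · A^{−η(d)|U|_{k+1}}`,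
`c(d) = (2^{d+1}+2)^d`, `η(d) = 1 + (2(2^d+1)+6)^{−d}`.
[cite: AdamsBuchholzKoteckyMuller2019, Theorem 6.8 / Lemma 9.6 (proof, first order)] -/
theorem tayNormLE_remainderThree_sub_abkm {L N Mord R n p r₀ : ℕ} {θbar lam μ δ₁ δ₀ A𝒫 h A : ℝ}
    {𝒞 : ℕ → (Fin d → ZMod M) → ℝ} (hd : 3 ≤ d) (hLodd : Odd L) (hL : 2 ^ (d + 3) + 16 * R ≤ L)
    (hR2 : 2 ≤ R) (hM : M = L ^ N) {k : ℕ} (hkN : k + 1 ≤ N) (hp : d / 2 + 1 ≤ p) (hMord : d / 2 + 1 ≤ Mord)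
    (hθbar : 0 < θbar) (hlam : 0 < lam)
    (hB : AbkmWeightBounds L N Mord R n θbar lam μ δ₁ δ₀ A𝒫 𝒞
      (abkmWeightData L N Mord R θbar (schedDelta δ₀ δ₁ N) 𝒞))
    (hδ₀ : 0 < δ₀) (hδ₁ : 0 < δ₁) (hh : 0 < h) (hh0 : hZeroSq d R δ₀ δ₁ ≤ h ^ 2) (hA𝒫 : 0 ≤ A𝒫) (hA1 : 1 ≤ A)
    {U : Finset (Fin d → ZMod M)} (hU : IsPolymer (L ^ (k + 1)) U) (hUne : U.Nonempty)
    {Ht Ht' H H' : RelevantHamiltonian ℂ d} {τ : ℝ}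
    (hHt : hamNorm (fieldWt h (L : ℝ) d k) ((L : ℝ) ^ k) (L ^ (d * k)) Ht ≤ τ)
    (hHt' : hamNorm (fieldWt h (L : ℝ) d k) ((L : ℝ) ^ k) (L ^ (d * k)) Ht' ≤ τ) (hτ : τ ≤ 1 / 16)
    (hH : hamNorm (fieldWt h (L : ℝ) d k) ((L : ℝ) ^ k) (L ^ (d * k)) H ≤ 1 / 16)
    (hH' : hamNorm (fieldWt h (L : ℝ) d k) ((L : ℝ) ^ k) (L ^ (d * k)) H' ≤ 1 / 16)
    {K K' : Finset (Fin d → ZMod M) → ((Fin d → ZMod M) → ℝ) → ℂ} {C CΔ : ℝ} (hC : 0 ≤ C) (hCΔ : 0 ≤ CΔ)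
    (hK : WeakNormLE (abkmNormParams L N Mord R p r₀ h θbar A (schedDelta δ₀ δ₁ N) 𝒞) k K C)
    (hK' : WeakNormLE (abkmNormParams L N Mord R p r₀ h θbar A (schedDelta δ₀ δ₁ N) 𝒞) k K' C)
    (hΔ : WeakNormLE (abkmNormParams L N Mord R p r₀ h θbar A (schedDelta δ₀ δ₁ N) 𝒞) k (K - K') CΔ)
    (hKfac : Factorises (L ^ k) K) (hK0 : ∀ φ, K ∅ φ = 1) (hKd : ∀ Y, ContDiff ℝ r₀ (K Y))
    (hK'fac : Factorises (L ^ k) K') (hK'0 : ∀ φ, K' ∅ φ = 1) (hK'd : ∀ Y, ContDiff ℝ r₀ (K' Y))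
    (hKloc : ∀ Y, IsPolymer (L ^ k) Y → IsConn Y →
      IsGaugeLocal ((abkmNormParams L N Mord R p r₀ h θbar A (schedDelta δ₀ δ₁ N) 𝒞).gauge k Y) (K Y))
    (hK'loc : ∀ Y, IsPolymer (L ^ k) Y → IsConn Y →
      IsGaugeLocal ((abkmNormParams L N Mord R p r₀ h θbar A (schedDelta δ₀ δ₁ N) 𝒞).gauge k Y) (K' Y))
    {ω κ : ℝ}
    (hθω : 8 * Real.exp (1 / 4) * τ +
      16 * Real.exp (3 / 8) * hamNorm (fieldWt h (L : ℝ) d k) ((L : ℝ) ^ k) (L ^ (d * k)) (Ht - Ht') ≤ ω)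
    (hbω : 8 * Real.exp (1 / 4) * hamNorm (fieldWt h (L : ℝ) d k) ((L : ℝ) ^ k) (L ^ (d * k)) H ≤ ω)
    (hb'ω : 8 * Real.exp (1 / 4) * hamNorm (fieldWt h (L : ℝ) d k) ((L : ℝ) ^ k) (L ^ (d * k)) H' +
      16 * Real.exp (3 / 8) * hamNorm (fieldWt h (L : ℝ) d k) ((L : ℝ) ^ k) (L ^ (d * k)) (H - H') ≤ ω)
    (hCω : C + CΔ ≤ ω) (hωA : ω * A ^ 2 ≤ 1)
    (hκ : 1 + Real.exp (1 / 4) +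
      16 * Real.exp (3 / 8) * hamNorm (fieldWt h (L : ℝ) d k) ((L : ℝ) ^ k) (L ^ (d * k)) (Ht - Ht') ≤ κ) :
    TayNormLE ((abkmNormParams L N Mord R p r₀ h θbar A (schedDelta δ₀ δ₁ N) 𝒞).gauge (k + 1) U) r₀
      ((abkmWeightData L N Mord R θbar (schedDelta δ₀ δ₁ N) 𝒞).weight (k + 1) U)
      (fun φ => ∑ X ∈ ((polys (L ^ k) univ).filter (fun X => reblock (L ^ k) (L * L ^ k) X = U)).filter
          (fun X => ¬ IsConn X),
        (bprod (L ^ k) (fun B => expNegH Ht B φ) (U \ X) * bprod (L ^ k) (fun B => expNegH (-Ht) B φ) (X \ U) *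
            (fluct (𝒞 (k + 1)) (polyP2 (L ^ k) H K X) φ + bprod (L ^ k) (fun B => 1 - expNegH Ht B φ) X) -
          bprod (L ^ k) (fun B => expNegH Ht' B φ) (U \ X) * bprod (L ^ k) (fun B => expNegH (-Ht') B φ) (X \ U) *
            (fluct (𝒞 (k + 1)) (polyP2 (L ^ k) H' K' X) φ + bprod (L ^ k) (fun B => 1 - expNegH Ht' B φ) X)))
      (κ ^ (blocks (L ^ k) U).card *
          ((3 * (16 * Real.exp (3 / 8) * hamNorm (fieldWt h (L : ℝ) d k) ((L : ℝ) ^ k) (L ^ (d * k)) (Ht - Ht')) +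
              16 * Real.exp (3 / 8) * hamNorm (fieldWt h (L : ℝ) d k) ((L : ℝ) ^ k) (L ^ (d * k)) (H - H') + CΔ) *
            (ω * A ^ 4)) *
        (((2 * (2 * κ * max 1 A𝒫)) ^ ((2 ^ (d + 1) + 2) ^ d * L ^ d) * (4 : ℝ) ^ ((2 ^ (d + 1) + 2) ^ d * L ^ d)) ^
            (blocks (L * L ^ k) U).card *
          A ^ (-((1 + 1 / ((2 * (2 ^ d + 1) + 6 : ℝ) ^ d)) * (blocks (L * L ^ k) U).card) : ℝ))) := by
  have hA : 0 < A := by linarith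
  set P := abkmNormParams L N Mord R p r₀ h θbar A (schedDelta δ₀ δ₁ N) 𝒞 with hP
  set T := (polys (L ^ k) univ).filter (fun X => reblock (L ^ k) (L * L ^ k) X = U) with hT
  set T₃ := T.filter (fun X => ¬ IsConn X) with hT₃
  have hT₃T : T₃ ⊆ T := filter_subset _ _
  have hT₃p : ∀ X ∈ T₃, IsPolymer (L ^ k) X := fun X hX => (mem_polys.1 (mem_filter.1 (hT₃T hX)).1).2
  have hT₃ne : ∀ X ∈ T₃, X.Nonempty := by
    intro X hX
    rw [nonempty_iff_ne_empty]
    rintro rfl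
    have hU0 : U = ∅ := by rw [← (mem_filter.1 (hT₃T hX)).2, reblock_empty]
    exact hUne.ne_empty hU0
  have hT₃nc : ∀ X ∈ T₃, ¬ IsConn X := fun X hX => (mem_filter.1 hX).2
  have h𝓨 : ∀ X ∈ T₃, ({∅, X} : Finset (Finset (Fin d → ZMod M))) ⊆ polys (L ^ k) X := by
    intro X hX X₁ hX₁
    rcases mem_insert.1 hX₁ with rfl | h1
    · exact empty_mem_polys _ _
    · rw [mem_singleton.1 h1]; exact self_mem_polys (hT₃p X hX)
  -- the explicit per-term Lipschitz bound, summed over `X₁ ∈ {∅, X}`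
  have htool := tayNormLE_subsum_reblockTerm_sub_abkm (n := n) (lam := lam) (μ := μ) hd hLodd hL hR2 hM hkN hp
    hMord hθbar hlam hB hδ₀ hδ₁ hh hh0 hA𝒫 hA hU (𝓧' := T₃) hT₃T
    (𝓨 := fun X => ({∅, X} : Finset (Finset (Fin d → ZMod M)))) h𝓨
    hHt hHt' hτ hH hH' hC hCΔ hK hK' hΔ hKfac hK0 hKd hK'fac hK'0 hK'd hKloc hK'loc
  -- the two reblocked terms of a disconnected preimage are the third remainder summand
  have hfun : (fun φ : (Fin d → ZMod M) → ℝ => ∑ X ∈ T₃, ∑ X₁ ∈ ({∅, X} : Finset (Finset (Fin d → ZMod M))),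
      (bprod (L ^ k) (fun B => expNegH Ht B φ) (U \ X) * bprod (L ^ k) (fun B => expNegH (-Ht) B φ) (X \ U) *
          (bprod (L ^ k) (fun B => 1 - expNegH Ht B φ) X₁ * fluct (𝒞 (k + 1)) (polyP2 (L ^ k) H K (X \ X₁)) φ) -
        bprod (L ^ k) (fun B => expNegH Ht' B φ) (U \ X) * bprod (L ^ k) (fun B => expNegH (-Ht') B φ) (X \ U) *
          (bprod (L ^ k) (fun B => 1 - expNegH Ht' B φ) X₁ *
            fluct (𝒞 (k + 1)) (polyP2 (L ^ k) H' K' (X \ X₁)) φ))) =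
      fun φ => ∑ X ∈ T₃,
        (bprod (L ^ k) (fun B => expNegH Ht B φ) (U \ X) * bprod (L ^ k) (fun B => expNegH (-Ht) B φ) (X \ U) *
            (fluct (𝒞 (k + 1)) (polyP2 (L ^ k) H K X) φ + bprod (L ^ k) (fun B => 1 - expNegH Ht B φ) X) -
          bprod (L ^ k) (fun B => expNegH Ht' B φ) (U \ X) * bprod (L ^ k) (fun B => expNegH (-Ht') B φ) (X \ U) *
            (fluct (𝒞 (k + 1)) (polyP2 (L ^ k) H' K' X) φ + bprod (L ^ k) (fun B => 1 - expNegH Ht' B φ) X)) := by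
    funext φ
    refine sum_congr rfl fun X hX => ?_
    rw [sum_pair (hT₃ne X hX).ne_empty.symm]
    simp only [bprod_empty, sdiff_empty, Finset.sdiff_self, polyP2_empty _ _ hK0, polyP2_empty _ _ hK'0,
      fluct_const]
    ring
  rw [hfun] at htool
  refine htool.mono ?_ (fun _ => (Real.exp_pos _).le)
  -- sizes and parities
  have h2dle : 2 ^ d ≤ 2 ^ (d + 3) := Nat.pow_le_pow_right (by norm_num) (by omega)
  have h1le : 1 ≤ 2 ^ d := Nat.one_le_two_pow
  have hL2 : 2 ^ d + 1 ≤ L := by omega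
  have hL4 : 4 ≤ L := by omega
  have hMo : Odd M := by rw [hM]; exact hLodd.pow
  have hsodd : Odd (L ^ k) := hLodd.pow
  have hU' : IsPolymer (L * L ^ k) U := by
    rw [show L * L ^ k = L ^ (k + 1) by rw [pow_succ']]; exact hU
  -- nonnegativity of the letters
  have hnn : ∀ H₀ : RelevantHamiltonian ℂ d,
      0 ≤ hamNorm (fieldWt h (L : ℝ) d k) ((L : ℝ) ^ k) (L ^ (d * k)) H₀ := fun H₀ =>
    hamNorm_nonneg (fieldWt_pos hh (by exact_mod_cast hLodd.pos) d k).le (by positivity) _ H₀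
  have hτ0 : 0 ≤ τ := (hnn Ht).trans hHt
  have haF : ∀ Z, P.aFactor k Z = (A ^ (blocks (L ^ k) Z).card)⁻¹ := fun Z => by
    rw [hP, NormParams.aFactor, abkmNormParams_A, abkmNormParams_L, card_blocks_eq_numBlocks]
  -- Step 1: the degree of the terms of a disconnected preimage
  have hstep : ∀ X ∈ T₃, ∀ X₁ ∈ ({∅, X} : Finset (Finset (Fin d → ZMod M))),
      ∀ Y ∈ polys (L ^ k) (X \ X₁), 2 ≤ (blocks (L ^ k) (X \ Y)).card + (components Y).card := by
    intro X hX X₁ hX₁ Y hY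
    have hXp := hT₃p X hX
    have h2 : 2 ≤ (blocks (L ^ k) X).card :=
      two_le_card_blocks_of_not_isConn hMo hsodd hXp (hT₃ne X hX) (hT₃nc X hX)
    rcases mem_insert.1 hX₁ with rfl | h1
    · rw [sdiff_empty] at hY
      by_cases hYX : Y = X
      · subst hYX; exact two_le_degree_self_of_not_isConn (L ^ k) (hT₃ne Y hX) (hT₃nc Y hX)
      · exact two_le_degree_of_ne_self hXp h2 hY hYX
    · rw [mem_singleton.1 h1, Finset.sdiff_self, polys_empty, mem_singleton] at hY
      subst hY
      rw [sdiff_empty]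
      exact h2.trans (Nat.le_add_right _ _)
  have hE0 : 0 ≤ κ ^ (blocks (L ^ k) U).card *
      ((3 * (16 * Real.exp (3 / 8) * hamNorm (fieldWt h (L : ℝ) d k) ((L : ℝ) ^ k) (L ^ (d * k)) (Ht - Ht')) +
          16 * Real.exp (3 / 8) * hamNorm (fieldWt h (L : ℝ) d k) ((L : ℝ) ^ k) (L ^ (d * k)) (H - H') + CΔ) *
        (ω * A ^ 4)) := by
    have h1 := hnn (Ht - Ht'); have h2 := hnn (H - H')
    have h3 : 0 ≤ 16 * Real.exp (3 / 8) *
        hamNorm (fieldWt h (L : ℝ) d k) ((L : ℝ) ^ k) (L ^ (d * k)) (Ht - Ht') := mul_nonneg (by positivity) h1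
    have hκ0 : 0 ≤ κ := by have := Real.exp_pos (1 / 4 : ℝ); linarith
    have hω0 : 0 ≤ ω := le_trans (by have := hnn H; positivity) hbω
    positivity
  have hc1 : (1 : ℝ) ≤ 2 * κ * max 1 A𝒫 := by
    have h3 : 0 ≤ 16 * Real.exp (3 / 8) *
        hamNorm (fieldWt h (L : ℝ) d k) ((L : ℝ) ^ k) (L ^ (d * k)) (Ht - Ht') := mul_nonneg (by positivity) (hnn _)
    have hκ1 : 1 ≤ κ := by have := Real.exp_pos (1 / 4 : ℝ); linarith
    have hm1 := le_max_left (1 : ℝ) A𝒫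
    have hκm : (1 : ℝ) * 1 ≤ κ * max 1 A𝒫 := mul_le_mul hκ1 hm1 zero_le_one (by linarith)
    linarith
  refine le_trans (sum_le_sum fun X hX => sum_le_sum fun X₁ hX₁ => ?_)
    (sum_reblock_triples_le_pow (d := d) hLodd hL2 hL4 hM hkN hA1 hc1 hE0 hU' (𝓧' := T₃) hT₃T
      (𝓨 := fun X => ({∅, X} : Finset (Finset (Fin d → ZMod M)))) h𝓨
      (𝓩 := fun X X₁ => polys (L ^ k) (X \ X₁)) (fun X _ X₁ _ => Subset.rfl)
      (F := fun X X₁ Y => (2 * κ * max 1 A𝒫) ^ (blocks (L ^ k) X).card *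
        (κ ^ (blocks (L ^ k) U).card *
          ((3 * (16 * Real.exp (3 / 8) * hamNorm (fieldWt h (L : ℝ) d k) ((L : ℝ) ^ k) (L ^ (d * k)) (Ht - Ht')) +
              16 * Real.exp (3 / 8) * hamNorm (fieldWt h (L : ℝ) d k) ((L : ℝ) ^ k) (L ^ (d * k)) (H - H') + CΔ) *
            (ω * A ^ 4))) *
        (A ^ (2 * (blocks (L ^ k) (X \ Y)).card + (blocks (L ^ k) Y).card + (components Y).card))⁻¹)
      (fun X _ X₁ _ Y _ => le_rfl))
  have hXp := hT₃p X hX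
  have hX₁p : X₁ ∈ polys (L ^ k) X := h𝓨 X hX hX₁
  exact reblockTerm_lipschitzConsts_le (U := U) (X := X) (X₁ := X₁) hMo hsodd hA1 (Real.exp_pos _).le
    (by have := hnn (Ht - Ht'); positivity) (by positivity) (by have := hnn H; positivity)
    (by have := hnn H'; positivity) (by have := hnn (H - H'); positivity) hC hCΔ hA𝒫 hθω hbω hb'ω hCω hωA hκ
    haF hXp hX₁p (hstep X hX X₁ hX₁)

end Literature.MathematicalPhysics.StatisticalMechanics.GradientRG

end
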